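import Summits.CriticalPhenomena.PercolationContinuityZ3.Theorems.PercFiniteBoxLRORenormaliseFromLinearLRODefs

/-!
# `stub_coarseDensity` of line `registered` (crux `PercFiniteBoxLRO.RenormaliseFromLinearLRO`,
# stmt-CriticalPhenomena-0857): coarse edges are open with probability `≥ 2 P_p(G_n) − 1`

Registered stub `stub_coarseDensity` of the lead's skeleton: the DENSITY input of the proved
dependent-percolation theorem
`Literature.Probability.Percolation.DuminilCopinSidoraviciusTassion2016_dependentPercolation_holds`
for the planar coarse good-edge configuration `coarseCfg n` (blocks `a ∈ ℤ²` ↦ boxes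
`blockCentre n a + B(n)` of `ℤ³`, objects file `PercFiniteBoxLRORenormaliseFromLinearLRODefs.lean`):
every lattice edge `e = {a, a + eᵢ}` of `ℤ²` is coarse-open (both blocks good) with
`P_p`-probability at least `2 · P_p(G_n) − 1`.

Proof (Grimmett 1999 §7.4 p.178; Duminil-Copin–Sidoravicius–Tassion 2016 §2.2):
* `e ∈ E(ℤ²)` has a presentation `s(a, a + eᵢ)` (`exists_base_of_mem_edgeSet`);
* `(coarseLaw n p).real {σ | e ∈ σ} = P_p (coarseCfg n ⁻¹' {σ | e ∈ σ})` (`map_measureReal_apply`,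
  `measurable_coarseCfg`, `measurableSet_mem`);
* `goodBlock n a ∩ goodBlock n (a + eᵢ) ⊆ coarseCfg n ⁻¹' {σ | e ∈ σ}` (witness `⟨a, i, rfl, _, _⟩`; only the
  lower bound is needed, no uniqueness of the presentation);
* `P_p (goodBlock n b) = P_p (G_n)` for every block `b` by translation invariance
  (`bondPercolation_real_preimage_shift` with `v = -blockCentre n b`);
* inclusion–exclusion `P(A ∩ B) ≥ P(A) + P(B) − 1` for the probability measure `P_p`
  (`measureReal_union_add_inter`, `measureReal_le_one`), then monotonicity (`measureReal_mono`).
The guard `1 ≤ n` of the registered signature is idle for this inequality.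
-/

namespace Summit.CriticalPhenomena.PercolationContinuityZ3.Theorems.RenormaliseFromLinearLRO

open Literature.Probability.Percolation Literature.Probability.LatticeModels
open MeasureTheory

/-- Translation invariance of the good-block probabilities: `P_p (goodBlock n a) = P_p (G_n)` for every
block `a` (`goodBlock n a` is the preimage of `G_n` under the shift of configurations by
`-blockCentre n a`; Grimmett 1999 §1.6 / §7.4 (7.58)). -/
theorem real_goodBlock (n : ℕ) (p : unitInterval) (a : Site 2) :
    (bondPercolation (zdGraph 3) p).real (goodBlock n a) =
      (bondPercolation (zdGraph 3) p).real (goodBox n) :=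
  bondPercolation_real_preimage_shift (-blockCentre n a) p (goodBox n)

/-- Inclusion–exclusion lower bound for a probability measure: `P(A) + P(B) − 1 ≤ P(A ∩ B)`
(from `P(A ∪ B) + P(A ∩ B) = P(A) + P(B)` and `P(A ∪ B) ≤ 1`). -/
theorem measureReal_add_sub_one_le_inter {α : Type*} [MeasurableSpace α] (μ : Measure α)
    [IsProbabilityMeasure μ] {A B : Set α} (hB : MeasurableSet B) :
    μ.real A + μ.real B - 1 ≤ μ.real (A ∩ B) := by
  have h1 : μ.real (A ∪ B) + μ.real (A ∩ B) = μ.real A + μ.real B :=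
    measureReal_union_add_inter hB
  have h2 : μ.real (A ∪ B) ≤ 1 := measureReal_le_one
  linarith

/-- Both blocks of a presented coarse edge being good forces the coarse edge to be open:
`goodBlock n a ∩ goodBlock n (a + eᵢ) ⊆ coarseCfg n ⁻¹' {σ | s(a, a + eᵢ) ∈ σ}`. -/
theorem inter_goodBlock_subset_preimage_coarseCfg (n : ℕ) (a : Site 2) (i : Fin 2) :
    goodBlock n a ∩ goodBlock n (a + Pi.single i 1) ⊆
      coarseCfg n ⁻¹' {σ : BondConfig (Site 2) | s(a, a + Pi.single i 1) ∈ σ} := by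
  intro ω hω
  simp only [Set.mem_preimage, Set.mem_setOf_eq, coarseCfg]
  exact ⟨a, i, rfl, hω.1, hω.2⟩

/-- **Registered stub `stub_coarseDensity` of crux stmt-CriticalPhenomena-0857 (line `registered`)**:
the density input of the planar coarse-graining — for `n ≥ 1`, every lattice edge `e` of `ℤ²` is open in
the coarse good-edge configuration with probability `(coarseLaw n p) {σ | e ∈ σ} ≥ 2 · P_p(G_n) − 1`
(both end-blocks good; translation invariance + inclusion–exclusion; Grimmett 1999 §7.4 p.178,
Duminil-Copin–Sidoravicius–Tassion 2016 §2.2). -/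
theorem stub_coarseDensity :
    ∀ (p : unitInterval) (n : ℕ), 1 ≤ n → ∀ e ∈ (zdGraph 2).edgeSet,
      2 * (bondPercolation (zdGraph 3) p).real (goodBox n) - 1 ≤ (coarseLaw n p).real {σ | e ∈ σ} := by
  intro p n _hn e he
  obtain ⟨a, i, rfl⟩ := exists_base_of_mem_edgeSet he
  rw [coarseLaw, map_measureReal_apply (measurable_coarseCfg n) (measurableSet_mem _)]
  calc 2 * (bondPercolation (zdGraph 3) p).real (goodBox n) - 1
      = (bondPercolation (zdGraph 3) p).real (goodBlock n a) +
          (bondPercolation (zdGraph 3) p).real (goodBlock n (a + Pi.single i 1)) - 1 := by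
        rw [real_goodBlock, real_goodBlock]; ring
    _ ≤ (bondPercolation (zdGraph 3) p).real (goodBlock n a ∩ goodBlock n (a + Pi.single i 1)) :=
        measureReal_add_sub_one_le_inter _ (measurableSet_goodBlock n _)
    _ ≤ (bondPercolation (zdGraph 3) p).real
          (coarseCfg n ⁻¹' {σ : BondConfig (Site 2) | s(a, a + Pi.single i 1) ∈ σ}) :=
        measureReal_mono (inter_goodBlock_subset_preimage_coarseCfg n a i)

end Summit.CriticalPhenomena.PercolationContinuityZ3.Theorems.RenormaliseFromLinearLRO
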